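import Summits.AtomisticToContinuum.BoseEinsteinCondensation.Theorems.BECRieszReverseHolderCoarseGrainedReverseHolderShadowInsertionSqLeTwoPinned
import Summits.AtomisticToContinuum.BoseEinsteinCondensation.Theorems.BECRieszReverseHolderCoarseGrainedReverseHolderShadowTwoPinnedLeStructureFactor
import Summits.AtomisticToContinuum.BoseEinsteinCondensation.Theorems.BECRieszReverseHolderCoarseGrainedReverseHolderVarianceReduction
import HarnessLib

/-!
# Shadow certification T3: the coarse reverse-Hölder functional of the shadow state
# (route BECRieszReverseHolder)

Line `registered` of crux stmt-AtomisticToContinuum-12840 (`CoarseGrainedReverseHolder`); registered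
sub-goals `shadow_coarseRH2_bound_of` (T3, the assembly) and `shadow_coarseRH2_bound` (the composed
certification). T1 = `shadow_insertionSq_le_twoPinned`, T2 = `shadow_twoPinned_le_structureFactor`
are landed and enter T3 as hypotheses.

With `g = periodicRieszKernel 2 L η`, `H_N(Y) = Σ_{i<j} g(Y_i - Y_j)`, `Z_N = ∫_{cell^N} e^{-bH_N}`,
cavity field `h_X(y) = Σ_j g(y - X_j)`, coupling `b ≥ 0` with `u₀ = b g(0) ≤ 1/2`, and the torus
cell cut into `m³` cubes `Q_k` of side `ℓ = L/m ≥ 2η`, the coarse reverse-Hölder functional of the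
shadow (Jastrow) state obeys
`m³ Σ_k ∫_{cell^n} e^{-bH_n} (∫_{Q_k} e^{-b h_X})² / ∫_{cell} e^{-b h_X}
   ≤ C (1 + L³ g(0) / ((n+1) ℓ)) Z_{n+1}`
with an absolute `C` (`= 2 e^{1/2} κ⁺ max(2, 1/K₂)`, `κ` the constant of T2,
`K₂ = rieszSubordinationConst 2`).

Proof (assembly + arithmetic). T1 summed over the cubes and T2 give
`LHS ≤ m³ (e^{u₀}/L³) κ ℓ³/((n+2)(n+1)) ∫_{cell^{n+2}} e^{-bH_{n+2}} (Σ_iΣ_j Θ_{L,ℓ²} + (n+2)²/L³)`;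
`m³ℓ³ = L³`; the unconditional engine `shadowStructureFactorBound` at `(n+2, t₀ = ℓ²)`
(`η² < ℓ²`, `√(ℓ²) - η = ℓ - η ≥ ℓ/2`) bounds the smooth structure factor by
`(n+2) g(0)/(K₂ ℓ) Z_{n+2}`; and the `θ = 1` pinned bound (`RieszFieldMoment.pinned_le` with
`u = b g`, Onsager's bound `stub_rieszKernelOnsagerBound`) integrated over the pin gives
`(1 - u₀) Z_{n+2} ≤ L³ Z_{n+1}`, i.e. `Z_{n+2} ≤ 2L³ Z_{n+1}` (`ShadowCoarseRH2.partition_succ_le`).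
The real arithmetic is isolated in `ShadowCoarseRH2.assembly_arith`.
-/

namespace Summit.AtomisticToContinuum.BoseEinsteinCondensation.Theorems.CoarseGrainedReverseHolder

open MeasureTheory
open Literature.MathematicalPhysics.QuantumManyBody
open Literature.MathematicalPhysics.StatisticalMechanics
open Literature.Analysis.UnboundedOperators
open BoseGas

namespace ShadowCoarseRH2

/-- **The real arithmetic of the assembly.** Chains the summed insertion bound `h1`, the
structure-factor domination `h2` with the split `h3`, the engine `h4` (at `t₀ = (L/m)²`) and the
pinned bound `h5` into the certified inequality with `C = 2 E κ⁺ max(2, 1/K)`. -/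
theorem assembly_arith {A T S I Z₁ Z₂ e E κ K g₀ L m n N₂ η u₀ : ℝ}
    (hL : 0 < L) (hm : 1 ≤ m) (hn : 0 ≤ n) (hN₂ : N₂ = n + 2) (hηℓ : 2 * η ≤ L / m)
    (hK : 0 < K) (hg₀ : 0 ≤ g₀) (hu₀ : u₀ ≤ 1 / 2) (he : 0 ≤ e) (heE : e ≤ E)
    (hZ₁ : 0 ≤ Z₁) (hZ₂ : 0 ≤ Z₂) (hS : 0 ≤ S)
    (h1 : A ≤ e / L ^ 3 * T)
    (h2 : T ≤ κ * (L / m) ^ 3 / ((n + 2) * (n + 1)) * S)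
    (h3 : S = I + (n + 2) ^ 2 / L ^ 3 * Z₂)
    (h4 : I ≤ N₂ * g₀ / (2 * K * (Real.sqrt ((L / m) ^ 2) - η)) * Z₂)
    (h5 : (1 - u₀) * Z₂ ≤ L ^ 3 * Z₁) :
    m ^ 3 * A ≤ 2 * E * max κ 0 * max 2 (1 / K) * (1 + L ^ 3 * g₀ / ((n + 1) * (L / m))) * Z₁ := by
  have hm0 : 0 < m := one_pos.trans_le hm
  have hℓ : 0 < L / m := div_pos hL hm0
  have hn1 : 0 < n + 1 := by linarith
  have hn2 : 0 < n + 2 := by linarith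
  have hE : 0 ≤ E := he.trans heE
  have hκ : κ ≤ max κ 0 := le_max_left _ _
  have hκ0 : 0 ≤ max κ 0 := le_max_right _ _
  have hM2 : 2 ≤ max 2 (1 / K) := le_max_left _ _
  have hMK : 1 / K ≤ max 2 (1 / K) := le_max_right _ _
  rw [hN₂, Real.sqrt_sq hℓ.le] at h4
  -- the engine's denominator: `2K(ℓ - η) ≥ Kℓ`
  have h4' : I ≤ (n + 2) * g₀ / (K * (L / m)) * Z₂ := by
    refine h4.trans (mul_le_mul_of_nonneg_right ?_ hZ₂)
    refine div_le_div_of_nonneg_left (by positivity) (by positivity) ?_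
    nlinarith [mul_nonneg hK.le (sub_nonneg.2 hηℓ)]
  -- `S ≤ B Z₂`, `Z₂ ≤ 2 L³ Z₁`, `T ≤ κ⁺ c B 2L³ Z₁`
  set B : ℝ := (n + 2) * g₀ / (K * (L / m)) + (n + 2) ^ 2 / L ^ 3 with hB
  have hB0 : 0 ≤ B := by positivity
  have hSB : S ≤ B * Z₂ := by
    rw [h3, hB, add_mul]
    linarith
  have hZ₂' : Z₂ ≤ 2 * L ^ 3 * Z₁ := by
    nlinarith [mul_nonneg (show (0 : ℝ) ≤ 1 / 2 - u₀ by linarith) hZ₂]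
  set c : ℝ := (L / m) ^ 3 / ((n + 2) * (n + 1)) with hc
  have hc0 : 0 ≤ c := by positivity
  have hT' : T ≤ max κ 0 * (c * (B * (2 * L ^ 3 * Z₁))) :=
    calc T ≤ κ * (L / m) ^ 3 / ((n + 2) * (n + 1)) * S := h2
      _ = κ * (c * S) := by rw [hc]; ring
      _ ≤ max κ 0 * (c * S) := mul_le_mul_of_nonneg_right hκ (mul_nonneg hc0 hS)
      _ ≤ max κ 0 * (c * (B * (2 * L ^ 3 * Z₁))) :=
          mul_le_mul_of_nonneg_left (mul_le_mul_of_nonneg_left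
            (hSB.trans (mul_le_mul_of_nonneg_left hZ₂' hB0)) hc0) hκ0
  -- the final comparison of the bracket with `max 2 (1/K) (1 + X)`
  have hX0 : 0 ≤ L ^ 3 * g₀ / ((n + 1) * (L / m)) := by positivity
  have hP : 1 / K * (L ^ 3 * g₀ / ((n + 1) * (L / m))) + (n + 2) / (n + 1) ≤
      max 2 (1 / K) * (1 + L ^ 3 * g₀ / ((n + 1) * (L / m))) := by
    have hb : (n + 2) / (n + 1) ≤ max 2 (1 / K) := by
      refine le_trans ?_ hM2
      rw [div_le_iff₀ hn1]
      linarith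
    calc 1 / K * (L ^ 3 * g₀ / ((n + 1) * (L / m))) + (n + 2) / (n + 1)
        ≤ max 2 (1 / K) * (L ^ 3 * g₀ / ((n + 1) * (L / m))) + max 2 (1 / K) :=
          add_le_add (mul_le_mul_of_nonneg_right hMK hX0) hb
      _ = _ := by ring
  have hP0 : 0 ≤ 1 / K * (L ^ 3 * g₀ / ((n + 1) * (L / m))) + (n + 2) / (n + 1) := by positivity
  calc m ^ 3 * A ≤ m ^ 3 * (e / L ^ 3 * (max κ 0 * (c * (B * (2 * L ^ 3 * Z₁))))) :=
        mul_le_mul_of_nonneg_left (h1.trans (mul_le_mul_of_nonneg_left hT' (by positivity)))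
          (by positivity)
    _ = 2 * e * max κ 0 *
          (1 / K * (L ^ 3 * g₀ / ((n + 1) * (L / m))) + (n + 2) / (n + 1)) * Z₁ := by
        rw [hc, hB]
        field_simp
    _ ≤ 2 * E * max κ 0 * (max 2 (1 / K) * (1 + L ^ 3 * g₀ / ((n + 1) * (L / m)))) * Z₁ := by
        refine mul_le_mul_of_nonneg_right ?_ hZ₁
        refine mul_le_mul ?_ hP hP0 (by positivity)
        exact mul_le_mul_of_nonneg_right (by linarith) hκ0
    _ = _ := by ring

/-- **Adding a particle costs at most `L³/(1 - b g(0))`.** For `g = periodicRieszKernel 2 L η`,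
`L > 0`, `b ≥ 0`, `η > 0` and every `N`: `(1 - b g(0)) Z_{N+2} ≤ L³ Z_{N+1}` with
`Z_M = ∫_{cell^M} e^{-b Σ_{i<j} g(Y_i - Y_j)}` — the `θ = 1` pinned bound
`RieszFieldMoment.pinned_le` for `u = b g` (continuous, even, periodic, Onsager) at every pin,
integrated over the pin
(`Z_{N+2} = ∫_{cell} (pinned integral) = L³ · (pinned integral at 0)` by Fubini and translation
invariance). -/
theorem partition_succ_le {N : ℕ} {L b η : ℝ} (hL : 0 < L) (hb : 0 ≤ b) (hη : 0 < η)
    {g : Space → ℝ} (hg : g = periodicRieszKernel 2 L η) :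
    (1 - b * g 0) * ∫ Y in cellN (N + 2) L,
        Real.exp (-(b * ∑ i : Fin (N + 2), ∑ j : Fin (N + 2) with i < j, g (Y i - Y j))) ≤
      L ^ 3 * ∫ X in cellN (N + 1) L,
        Real.exp (-(b * ∑ i : Fin (N + 1), ∑ j : Fin (N + 1) with i < j, g (X i - X j))) := by
  have hηne : η ≠ 0 := hη.ne'
  have hgc : Continuous g := by rw [hg]; exact continuous_periodicRieszKernel 2 hL hηne
  set u : Space → ℝ := fun z => b * g z with hu_def
  have hu : Continuous u := continuous_const.fun_mul hgc
  have heven : ∀ z, u (-z) = u z := fun z => by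
    simp only [hu_def, hg, periodicRieszKernel_neg]
  have hper : ∀ (z : Space) (k : Fin 3), u (z + EuclideanSpace.single k L) = u z := fun z k => by
    simp only [hu_def, hg, periodicRieszKernel_add_single]
  have hons : ∀ (M : ℕ) (X : Config M), -((M : ℝ) * u 0 / 2) ≤
      ∑ i : Fin M, ∑ j : Fin M with i < j, u (X i - X j) := by
    intro M X
    have h := mul_le_mul_of_nonneg_left (stub_rieszKernelOnsagerBound 2 L η two_pos hL hηne M X) hb
    rw [Finset.mul_sum] at h
    simp only [Finset.mul_sum] at h
    simp only [hu_def, hg]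
    linarith
  -- the pinned integral, its translation invariance and its integral over the pin
  set D : Space → ℝ := fun y => ∫ X in cellN (N + 1) L,
    Real.exp (-(∑ a : Fin (N + 1), ∑ c : Fin (N + 1) with a < c, u (X a - X c)) -
      ∑ j : Fin (N + 1), u (y - X j)) with hD
  have hD0 : ∀ y, D y = D 0 := fun y => by
    have h := RieszFieldMoment.setIntegral_pinned_eq (n := N + 1) hL u hu heven hper
      (Φ := fun _ => (1 : ℝ)) continuous_const y
    simpa only [one_mul] using h
  have hDint : ∫ y in cell L, D y = ∫ Y in cellN (N + 2) L,
      Real.exp (-(∑ a : Fin (N + 2), ∑ c : Fin (N + 2) with a < c, u (Y a - Y c))) := by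
    have h := RieszFieldMoment.integral_cell_setIntegral_pinned (n := N + 1) (L := L) u hu
      (Φ := fun _ => (1 : ℝ)) continuous_const
    simpa only [one_mul] using h
  have hvol : (volume.restrict (cell L)).real Set.univ = L ^ 3 := by
    rw [measureReal_restrict_apply_univ, Measure.real, volume_cell, ← ENNReal.ofReal_pow hL.le,
      ENNReal.toReal_ofReal (by positivity)]
  have hDc : ∫ y in cell L, D y = L ^ 3 * D 0 := by
    rw [funext hD0]
    simp only [integral_const, smul_eq_mul, hvol]
  have hpin : (1 - u 0) * D 0 ≤ ∫ X in cellN (N + 1) L,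
      Real.exp (-(∑ a : Fin (N + 1), ∑ c : Fin (N + 1) with a < c, u (X a - X c))) :=
    RieszFieldMoment.pinned_le (n := N + 1) hL u hu heven hper hons 0
  have key : (1 - u 0) * ∫ Y in cellN (N + 2) L,
      Real.exp (-(∑ a : Fin (N + 2), ∑ c : Fin (N + 2) with a < c, u (Y a - Y c))) ≤
      L ^ 3 * ∫ X in cellN (N + 1) L,
        Real.exp (-(∑ a : Fin (N + 1), ∑ c : Fin (N + 1) with a < c, u (X a - X c))) := by
    rw [← hDint, hDc]
    calc (1 - u 0) * (L ^ 3 * D 0) = L ^ 3 * ((1 - u 0) * D 0) := by ring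
      _ ≤ _ := mul_le_mul_of_nonneg_left hpin (by positivity)
  simpa only [hu_def, Finset.mul_sum] using key

end ShadowCoarseRH2

open ShadowCoarseRH2 in
/-- **Shadow certification, T3 (assembly).** Given the one-cube insertion bound T1 and the
structure-factor domination T2, there is an absolute `C` such that for
`g = periodicRieszKernel 2 L η`, `L > 0`, `b ≥ 0`, `η > 0`, `m ≥ 1`, `L/m ≥ 2η` and
`b g(0) ≤ 1/2`, the coarse reverse-Hölder
functional of the shadow state is at most `C (1 + L³ g(0)/((n+1)(L/m))) Z_{n+1}`. -/
theorem shadow_coarseRH2_bound_of : (∀ (n m : ℕ) (L b η : ℝ), 0 < L → 0 ≤ b → 0 < η → ∀ g : BoseGas.Space → ℝ, g = periodicRieszKernel 2 L η → ∀ k : Fin 3 → Fin m, ∫ X in BoseGas.cellN n L, Real.exp (-(b * ∑ i : Fin n, ∑ j : Fin n with i < j, g (X i - X j))) * (∫ y in {y : EuclideanSpace ℝ (Fin 3) | ∀ i, y i ∈ Set.Ico ((k i : ℝ) * (L / m)) (((k i : ℝ) + 1) * (L / m))}, Real.exp (-(b * ∑ j : Fin n, g (y - X j)))) ^ 2 /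 (∫ y in BoseGas.cell L, Real.exp (-(b * ∑ j : Fin n, g (y - X j)))) ≤ Real.exp (b * g 0) / L ^ 3 * ∫ y in {y : EuclideanSpace ℝ (Fin 3) | ∀ i, y i ∈ Set.Ico ((k i : ℝ) * (L / m)) (((k i : ℝ) + 1) * (L / m))}, ∫ y' in {y : EuclideanSpace ℝ (Fin 3) | ∀ i, y i ∈ Set.Ico ((k i : ℝ) * (L / m)) (((k i : ℝ) + 1) * (L / m))}, ∫ X in BoseGas.cellN n L, Real.exp (-(b * ∑ i : Fin (n + 2), ∑ j : Fin (n + 2) with i < j, g (Matrix.vecCons y (Matrix.vecCons y' X) i - Matrix.vecCons y (Matrix.vecCons y' X) j)))) → (∃ κ : ℝ, ∀ (n m : ℕ) (L b η : ℝ), 0 < L → 0 ≤ b → 0 < η → 1 ≤ m → ∀ g : BoseGas.Space → ℝ, g = periodicRieszKernel 2 L η → ∑ k : Fin 3 → Fin m, ∫ y in {y : EuclideanSpace ℝ (Fin 3) | ∀ i, y i ∈ Set.Ico ((k i : ℝ) * (L / m)) (((k i : ℝ) + 1) * (L / m))}, ∫ y' in {y : EuclideanSpace ℝ (Fin 3)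 | ∀ i, y i ∈ Set.Ico ((k i : ℝ) * (L / m)) (((k i : ℝ) + 1) * (L / m))}, ∫ X in BoseGas.cellN n L, Real.exp (-(b * ∑ i : Fin (n + 2), ∑ j : Fin (n + 2) with i < j, g (Matrix.vecCons y (Matrix.vecCons y' X) i - Matrix.vecCons y (Matrix.vecCons y' X) j))) ≤ κ * (L / m) ^ 3 / (((n : ℝ) + 2) * ((n : ℝ) + 1)) * ∫ Y in BoseGas.cellN (n + 2) L, Real.exp (-(b * ∑ i : Fin (n + 2), ∑ j : Fin (n + 2) with i < j, g (Y i - Y j))) * (∑ i : Fin (n + 2), ∑ j : Fin (n + 2), periodicHeatSum L ((L / m) ^ 2) (Y i - Y j) + ((n : ℝ) + 2) ^ 2 / L ^ 3)) → ∃ C : ℝ, ∀ (n m : ℕ) (L b η : ℝ), 0 < L → 0 ≤ b → 0 < η → 1 ≤ m → 2 * η ≤ L / m → ∀ g : BoseGas.Space → ℝ, g = periodicRieszKernel 2 L η → b * g 0 ≤ 1 / 2 → (m : ℝ) ^ 3 * ∑ k : Fin 3 → Fin m, ∫ X in BoseGas.cellN n L, Real.exp (-(b * ∑ i : Fin n,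 ∑ j : Fin n with i < j, g (X i - X j))) * (∫ y in {y : EuclideanSpace ℝ (Fin 3) | ∀ i, y i ∈ Set.Ico ((k i : ℝ) * (L / m)) (((k i : ℝ) + 1) * (L / m))}, Real.exp (-(b * ∑ j : Fin n, g (y - X j)))) ^ 2 / (∫ y in BoseGas.cell L, Real.exp (-(b * ∑ j : Fin n, g (y - X j)))) ≤ C * (1 + L ^ 3 * g 0 / (((n : ℝ) + 1) * (L / m))) * ∫ Y in BoseGas.cellN (n + 1) L, Real.exp (-(b * ∑ i : Fin (n + 1), ∑ j : Fin (n + 1) with i < j, g (Y i - Y j))) := by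
  intro hT1 hT2
  obtain ⟨κ, hκ⟩ := hT2
  refine ⟨2 * Real.exp (1 / 2) * max κ 0 * max 2 (1 / rieszSubordinationConst 2), ?_⟩
  intro n m L b η hL hb hη hm hηℓ g hg hbg
  have hηne : η ≠ 0 := hη.ne'
  have hm0 : (0 : ℝ) < m := by exact_mod_cast hm
  have hℓ : 0 < L / m := div_pos hL hm0
  have hgc : Continuous g := by rw [hg]; exact continuous_periodicRieszKernel 2 hL hηne
  have hg0 : 0 ≤ g 0 := by rw [hg]; exact periodicRieszKernel_zero_nonneg two_pos hL hηne
  have hK : 0 < rieszSubordinationConst 2 := rieszSubordinationConst_pos two_pos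
  -- (1) the insertion bound T1 summed over the cubes
  have h1 := Finset.sum_le_sum fun k (_ : k ∈ (Finset.univ : Finset (Fin 3 → Fin m))) =>
    hT1 n m L b η hL hb hη g hg k
  rw [← Finset.mul_sum] at h1
  -- (2) the structure-factor domination T2
  have h2 := hκ n m L b η hL hb hη hm g hg
  -- (3) splitting the structure-factor integral
  have hΘc : Continuous (periodicHeatSum L ((L / m) ^ 2)) :=
    continuous_periodicHeatSum hL (pow_pos hℓ 2)
  have hDc : Continuous fun Y : Config (n + 2) =>
      ∑ i : Fin (n + 2), ∑ j : Fin (n + 2), periodicHeatSum L ((L / m) ^ 2) (Y i - Y j) :=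
    continuous_finsetSum _ fun i _ => continuous_finsetSum _ fun j _ =>
      hΘc.comp ((continuous_apply i).sub (continuous_apply j))
  have hwc : Continuous fun Y : Config (n + 2) =>
      Real.exp (-(b * ∑ i : Fin (n + 2), ∑ j : Fin (n + 2) with i < j, g (Y i - Y j))) := by
    fun_prop
  have h3 : ∫ Y in cellN (n + 2) L,
      Real.exp (-(b * ∑ i : Fin (n + 2), ∑ j : Fin (n + 2) with i < j, g (Y i - Y j))) *
        (∑ i : Fin (n + 2), ∑ j : Fin (n + 2), periodicHeatSum L ((L / m) ^ 2) (Y i - Y j) +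
          ((n : ℝ) + 2) ^ 2 / L ^ 3) =
      (∫ Y in cellN (n + 2) L,
        (∑ i : Fin (n + 2), ∑ j : Fin (n + 2), periodicHeatSum L ((L / m) ^ 2) (Y i - Y j)) *
          Real.exp (-(b * ∑ i : Fin (n + 2), ∑ j : Fin (n + 2) with i < j, g (Y i - Y j)))) +
        ((n : ℝ) + 2) ^ 2 / L ^ 3 * ∫ Y in cellN (n + 2) L,
          Real.exp (-(b * ∑ i : Fin (n + 2), ∑ j : Fin (n + 2) with i < j, g (Y i - Y j))) :=
    calc _ = ∫ Y in cellN (n + 2) L,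
          ((∑ i : Fin (n + 2), ∑ j : Fin (n + 2), periodicHeatSum L ((L / m) ^ 2) (Y i - Y j)) *
            Real.exp (-(b * ∑ i : Fin (n + 2), ∑ j : Fin (n + 2) with i < j, g (Y i - Y j))) +
          ((n : ℝ) + 2) ^ 2 / L ^ 3 *
            Real.exp (-(b * ∑ i : Fin (n + 2), ∑ j : Fin (n + 2) with i < j, g (Y i - Y j)))) :=
          setIntegral_congr_fun (measurableSet_cellN _ L) fun Y _ => by ring
      _ = _ := integral_add (integrableOn_cellN (hDc.fun_mul hwc) L)
          (integrableOn_cellN (continuous_const.fun_mul hwc) L)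
      _ = _ := by rw [integral_const_mul]
  -- (4) the engine at `(n + 2, t₀ = (L/m)²)`
  have hη2 : η ^ 2 < (L / m) ^ 2 := by
    have hlt : η < L / m := by linarith
    exact pow_lt_pow_left₀ hlt hη.le two_ne_zero
  have h4 : ∫ X in cellN (n + 2) L,
      (∑ i : Fin (n + 2), ∑ j : Fin (n + 2), periodicHeatSum L ((L / m) ^ 2) (X i - X j)) *
        Real.exp (-(b * ∑ i : Fin (n + 2), ∑ j : Fin (n + 2) with i < j, g (X i - X j))) ≤
      ((n + 2 : ℕ) : ℝ) * g 0 / (2 * rieszSubordinationConst 2 * (Real.sqrt ((L / m) ^ 2) - η)) *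
        ∫ X in cellN (n + 2) L,
          Real.exp (-(b * ∑ i : Fin (n + 2), ∑ j : Fin (n + 2) with i < j, g (X i - X j))) := by
    have h := shadowStructureFactorBound (n + 2) L b η ((L / m) ^ 2) hL hb hη hη2 _ rfl
    rw [← hg] at h
    exact h
  -- (5) the pinned bound
  have h5 := partition_succ_le (N := n) hL hb hη hg
  -- signs
  have hZ1 : 0 ≤ ∫ Y in cellN (n + 1) L,
      Real.exp (-(b * ∑ i : Fin (n + 1), ∑ j : Fin (n + 1) with i < j, g (Y i - Y j))) :=
    setIntegral_nonneg (measurableSet_cellN _ L) fun Y _ => (Real.exp_pos _).le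
  have hZ2 : 0 ≤ ∫ Y in cellN (n + 2) L,
      Real.exp (-(b * ∑ i : Fin (n + 2), ∑ j : Fin (n + 2) with i < j, g (Y i - Y j))) :=
    setIntegral_nonneg (measurableSet_cellN _ L) fun Y _ => (Real.exp_pos _).le
  have hDD0 : ∀ Y : Config (n + 2),
      0 ≤ ∑ i : Fin (n + 2), ∑ j : Fin (n + 2), periodicHeatSum L ((L / m) ^ 2) (Y i - Y j) :=
    fun Y => by
    have h := sum_sum_mul_periodicHeatSum_nonneg' hL (pow_pos hℓ 2) Y fun _ => (1 : ℝ)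
    simpa only [one_mul] using h
  have hS : 0 ≤ ∫ Y in cellN (n + 2) L,
      Real.exp (-(b * ∑ i : Fin (n + 2), ∑ j : Fin (n + 2) with i < j, g (Y i - Y j))) *
        (∑ i : Fin (n + 2), ∑ j : Fin (n + 2), periodicHeatSum L ((L / m) ^ 2) (Y i - Y j) +
          ((n : ℝ) + 2) ^ 2 / L ^ 3) :=
    setIntegral_nonneg (measurableSet_cellN _ L) fun Y _ =>
      mul_nonneg (Real.exp_pos _).le (add_nonneg (hDD0 Y) (by positivity))
  -- (6) arithmetic
  exact assembly_arith (m := (m : ℝ)) (n := (n : ℝ)) hL (Nat.one_le_cast.2 hm) n.cast_nonneg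
    (by push_cast; ring) hηℓ hK hg0 hbg (Real.exp_pos _).le (Real.exp_le_exp.2 hbg)
    hZ1 hZ2 hS h1 h2 h3 h4 h5

/-- **Shadow certification (composed).** The coarse reverse-Hölder functional of the shadow
(Jastrow) state of the smeared Riesz-2 gas is bounded by `C (1 + L³ g(0)/((n+1)(L/m))) Z_{n+1}`
at all scales `L/m ≥ 2η` with `b g(0) ≤ 1/2`: T3 applied to the landed T1 and T2. -/
theorem shadow_coarseRH2_bound : ∃ C : ℝ, ∀ (n m : ℕ) (L b η : ℝ), 0 < L → 0 ≤ b → 0 < η → 1 ≤ m → 2 * η ≤ L / m → ∀ g : BoseGas.Space → ℝ, g = periodicRieszKernel 2 L η → b * g 0 ≤ 1 / 2 → (m : ℝ) ^ 3 * ∑ k : Fin 3 → Fin m, ∫ X in BoseGas.cellN n L, Real.exp (-(b * ∑ i : Fin n, ∑ j : Fin n with i < j, g (X i - X j))) * (∫ y in {y : EuclideanSpace ℝ (Fin 3) | ∀ i, y i ∈ Set.Ico ((k i : ℝ) * (L / m)) (((k i : ℝ) + 1) * (L / m))}, Real.exp (-(b * ∑ j : Fin n, g (y - X j)))) ^ 2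 / (∫ y in BoseGas.cell L, Real.exp (-(b * ∑ j : Fin n, g (y - X j)))) ≤ C * (1 + L ^ 3 * g 0 / (((n : ℝ) + 1) * (L / m))) * ∫ Y in BoseGas.cellN (n + 1) L, Real.exp (-(b * ∑ i : Fin (n + 1), ∑ j : Fin (n + 1) with i < j, g (Y i - Y j))) :=
  shadow_coarseRH2_bound_of shadow_insertionSq_le_twoPinned shadow_twoPinned_le_structureFactor

end Summit.AtomisticToContinuum.BoseEinsteinCondensation.Theorems.CoarseGrainedReverseHolder
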